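import Summits.ValiantsHypothesis.ValiantsHypothesis.Theses.KPlusLogSqLawOctave

/-!
# Octave route «KPlusLogSqLawOctave» — OCTAVE MONSTERS FROM TROPICAL MONSTERS: the route's two cruxes are jointly
# EXACTLY the hypothesis-free octave law Ω-B  (ideator val-idea-11 g5, lens `wuc`; sorry-free support file)

HONEST FRAMING.  Sorry-free.  Cruxes `TropicalB` (stmt-ValiantsHypothesis-19771) and `OctaveWeakLifting` (Ω-W, stmt-ValiantsHypothesis-24457)
of the DRAFT route `KPlusLogSqLawOctave` (`closes (hT : TropicalB) (hΩ : OctaveWeakLifting)`).  Every theorem is an implication /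
equivalence between OPEN statements or an unconditional lower-bound construction; nothing is asserted about `TropicalB`, Ω-W, Ω-B,
`WeakLifting`, `MatrixDescartes` (stmt-18050) or VP ≠ VNP — **VP ≠ VNP is not moved by this file**.

THE POINT.  The landed glue proves `TropicalB ∧ Ω-W → Ω-B` (`OctaveGlue.octaveKLaw_of_tropicalB_of_octaveWeakLifting`), where
Ω-B (`OctaveDefs.OctaveKLaw`, spelled inline here over `OctaveGlue.OctaveRootLawAt`) is the hypothesis-free law «every real symmetric
lacunary pencil of format `(m,K)` has its nonzero real roots in `≤ 2^(C(K+⌊log₂m⌋²))` dyadic octaves».  This file proves the converse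
`Ω-B → TropicalB ∧ Ω-W` (`tropicalB_of_octaveKLaw`, `octaveWeakLifting_of_octaveKLaw`), hence

  `octaveKLaw_iff : Ω-B ↔ TropicalB ∧ OctaveWeakLifting`      — the octave route IS the single statement Ω-B, split without slack.

The new half is PATCHWORKING IN OCTAVE CURRENCY: a signed dominant chain of a tropical design of format `(m,K)` with `n` sign
alternations at integer slopes `θ₀ < … < θ_n` is realised (tree: `patchMatrix`, `det_patch_alternates`, base `b = 2^g`,
`g = |S_m × [K]^m| + 1`) by a real pencil whose determinant alternates in sign at the points `2^(g·θ_k)`; the `n` roots so produced lie in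
the pairwise disjoint octave ranges `[g·θ_k, g·θ_{k+1})` (`le_octaveCount_of_alternating_zpow` — the dyadic-base twin of the tree's
`le_octaveCount_of_alternating_xPt`), and the tree's SYMMETRIC DOUBLING `[[0,P],[Pᵀ,1]]` (`MatrixDescartes.Negative.SD`, `det = ±(det P)²`,
format `(2m, K+1)`) keeps the root set, hence the octave count (`octaveCount_C_mul_sq`).  So `T(m,K) ≤ Ω(2m, K+1)`
(`octaves_of_signedChain`): every tropical monster is an octave monster, and Ω-B at `(2m,K+1)` gives `TropicalB` with `C ↦ 4C`.

CONSEQUENCES (recorded, not staffed).  (i) For the custodian: the 2-crux split `TropicalB ∧ Ω-W` of the octave route has NO slack — any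
weakening of either crux that keeps `closes` must leave Ω-B; conversely a refutation of Ω-B (an octave monster) refutes the ROUTE but
not necessarily either crux separately.  (ii) Negative-knowledge transfer: `¬TropicalB → ¬Ω-B` (`not_octaveKLaw_of_not_tropicalB`): a
tropical monster kills the octave law exactly as it kills `MatrixDescartes` (tree `MatrixDescartes_false_of_TropicalMonster`).
(iii) With the same seat's `Lines/octave_aspect.lean` (`TropicalB → OctaveFatLifting → Ω-W`) and the tropical regime collapse
(`…TropicalBRegimeCollapse`): Ω-B ↔ TB-fat ∧ Ω-W-fat — the whole octave route is a FAT-REGIME pair of statements.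
[folklore] patchworking / IVT / symmetric doubling bookkeeping over tree lemmas; the laws are cell conjectures (no citation exists).
-/

set_option linter.dupNamespace false
set_option autoImplicit false

namespace Summit.ValiantsHypothesis.ValiantsHypothesis.Cruxes.OctaveWeakLifting.OctaveExact

open Polynomial Finset
open scoped BigOperators
open Summit.ValiantsHypothesis.ValiantsHypothesis.Theorems.MatrixDescartes.Negative
  (patchMatrix termSign IsDominant det_patch_alternates SD dD SD_isSymm det_pencil_SD)
open Summit.ValiantsHypothesis.ValiantsHypothesis.Theorems.KPlusLogSqLaw.OctaveGlue
  (octave octaveCount OctaveRootLawAt octaveRootLawAt_mono octaveKLaw_of_tropicalB_of_octaveWeakLifting)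
open Summit.ValiantsHypothesis.ValiantsHypothesis.Theorems.SymmetroidDescartes (eval_det_pencil)
open Summit.ValiantsHypothesis.ValiantsHypothesis.Theses.KPlusLogSqLawOctave (TropicalB OctaveWeakLifting)

/-! ## 1. Roots in distinct octaves from sign alternation at dyadic-power points -/

/-- **Octave form of the alternation-to-roots lemma at the points `2^(g·θ_k)`** (`g ≥ 1`, `θ` strictly increasing integers):
`n` sign alternations give `n` real roots in `n` DISTINCT dyadic octaves, since the root found in `(2^(gθ_k), 2^(gθ_{k+1}))` has
octave in `[gθ_k, gθ_{k+1})`. [folklore] -/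
theorem le_octaveCount_of_alternating_zpow (p : ℝ[X]) (hp : p ≠ 0) {n : ℕ} (g : ℕ) (hg : 1 ≤ g)
    (θ : Fin (n + 1) → ℤ) (hθ : StrictMono θ)
    (halt : ∀ k : Fin n, p.eval ((2 : ℝ) ^ ((g : ℤ) * θ k.castSucc)) * p.eval ((2 : ℝ) ^ ((g : ℤ) * θ k.succ)) < 0) :
    n ≤ octaveCount p := by
  classical
  set τ : Fin (n + 1) → ℝ := fun k => (2 : ℝ) ^ ((g : ℤ) * θ k) with hτ
  have hgθ : StrictMono fun k => (g : ℤ) * θ k := fun i j hij => by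
    have := hθ hij
    have hg' : (0 : ℤ) < g := by exact_mod_cast hg
    exact Int.mul_lt_mul_of_pos_left this hg'
  have hτmono : StrictMono τ := fun i j hij => zpow_lt_zpow_right₀ one_lt_two (hgθ hij)
  have hτpos : ∀ k, 0 < τ k := fun k => zpow_pos two_pos _
  have hroot : ∀ k : Fin n, ∃ r, τ k.castSucc < r ∧ r < τ k.succ ∧ p.IsRoot r := by
    intro k
    have hlt : τ k.castSucc < τ k.succ := hτmono (Fin.castSucc_lt_succ (i := k))
    have hcont := p.continuousOn (s := Set.Icc (τ k.castSucc) (τ k.succ))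
    rcases mul_neg_iff.1 (halt k) with ⟨ha, hb⟩ | ⟨ha, hb⟩
    · obtain ⟨r, hr, hr0⟩ := intermediate_value_Ioo' hlt.le hcont ⟨hb, ha⟩
      exact ⟨r, hr.1, hr.2, hr0⟩
    · obtain ⟨r, hr, hr0⟩ := intermediate_value_Ioo hlt.le hcont ⟨ha, hb⟩
      exact ⟨r, hr.1, hr.2, hr0⟩
  choose r hr using hroot
  have hrpos : ∀ k, 0 < r k := fun k => (hτpos _).trans (hr k).1
  have hup : ∀ k : Fin n, octave (r k) < (g : ℤ) * θ k.succ := by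
    intro k
    have hpos : 0 < |r k| := abs_pos.2 (hrpos k).ne'
    have h1 : |r k| < ((2 : ℕ) : ℝ) ^ ((g : ℤ) * θ k.succ) := by
      rw [abs_of_pos (hrpos k), Nat.cast_ofNat]; exact (hr k).2.1
    exact (Int.lt_zpow_iff_log_lt (b := 2) (by norm_num) hpos).1 h1
  have hlow : ∀ k : Fin n, (g : ℤ) * θ k.castSucc ≤ octave (r k) := by
    intro k
    have hpos : 0 < |r k| := abs_pos.2 (hrpos k).ne'
    have h1 : ((2 : ℕ) : ℝ) ^ ((g : ℤ) * θ k.castSucc) ≤ |r k| := by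
      rw [abs_of_pos (hrpos k), Nat.cast_ofNat]; exact (hr k).1.le
    exact (Int.zpow_le_iff_le_log (b := 2) (by norm_num) hpos).1 h1
  have hinj : Function.Injective fun k : Fin n => octave (r k) := by
    intro k k' hkk'
    by_contra hne
    rcases lt_or_gt_of_ne hne with h | h
    · have h2 : (g : ℤ) * θ k.succ ≤ (g : ℤ) * θ k'.castSucc :=
        (hgθ.monotone (show k.succ ≤ k'.castSucc from h))
      have := hup k; have := hlow k'; simp only at hkk'; omega
    · have h2 : (g : ℤ) * θ k'.succ ≤ (g : ℤ) * θ k.castSucc :=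
        (hgθ.monotone (show k'.succ ≤ k.castSucc from h))
      have := hup k'; have := hlow k; simp only at hkk'; omega
  have hsub : (univ : Finset (Fin n)).image (fun k => octave (r k)) ⊆
      (p.roots.toFinset.filter (fun x => x ≠ 0)).image octave := by
    intro y hy
    obtain ⟨k, _, rfl⟩ := mem_image.1 hy
    refine mem_image.2 ⟨r k, ?_, rfl⟩
    rw [mem_filter, Multiset.mem_toFinset, mem_roots hp]
    exact ⟨(hr k).2.2, (hrpos k).ne'⟩
  calc n = ((univ : Finset (Fin n)).image (fun k => octave (r k))).card := by
          rw [card_image_of_injective _ hinj, card_univ, Fintype.card_fin]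
    _ ≤ _ := card_le_card hsub

/-! ## 2. Octave count is blind to squaring and nonzero constants -/

/-- `octaveCount (C c * q²) = octaveCount q` for `c ≠ 0`: the octave statistic sees only the root SET. [folklore] -/
theorem octaveCount_C_mul_sq (c : ℝ) (hc : c ≠ 0) (q : ℝ[X]) : octaveCount (C c * q ^ 2) = octaveCount q := by
  unfold octaveCount
  rw [roots_C_mul _ hc, roots_pow, Multiset.toFinset_nsmul _ _ two_ne_zero]

/-! ## 3. A signed dominant chain of format `(m, K)` gives a SYMMETRIC pencil of format `(2m, K+1)` with ≥ `n` root octaves -/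

/-- **Octave patchworking + symmetric doubling.**  `T(m,K) ≤ Ω(2m, K+1)` in the cell's notation. -/
theorem octaves_of_signedChain {m K n : ℕ} (d : Fin K → ℕ) (v ε : Fin m → Fin m → Fin K → ℤ)
    (hε : ∀ i j l, (ε i j l).natAbs ≤ 1) (θ : Fin (n + 1) → ℤ) (hθ : StrictMono θ)
    (p : Fin (n + 1) → Equiv.Perm (Fin m) × (Fin m → Fin K))
    (hdom : ∀ k, IsDominant d v ε (θ k) (p k))
    (halt : ∀ k : Fin n, termSign ε (p k.castSucc) * termSign ε (p k.succ) < 0) :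
    ∃ S : Fin (K + 1) → Matrix (Fin (m + m)) (Fin (m + m)) ℝ, (∀ l, (S l).IsSymm) ∧
      n ≤ octaveCount (Matrix.det (∑ l, ((Polynomial.X : Polynomial ℝ) ^ dD d l) • (S l).map Polynomial.C)) := by
  classical
  set N : ℕ := Fintype.card (Equiv.Perm (Fin m) × (Fin m → Fin K)) with hN
  set g : ℕ := N + 1 with hg
  set b : ℝ := (2 : ℝ) ^ (g : ℤ) with hb
  have hbN : (N : ℝ) < b := by
    have h1 : N < 2 ^ g := (Nat.lt_two_pow_self).trans (Nat.pow_lt_pow_right one_lt_two (Nat.lt_succ_self N))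
    have h2 : ((2 ^ g : ℕ) : ℝ) = b := by rw [hb, zpow_natCast]; push_cast; ring
    rw [← h2]; exact_mod_cast h1
  have hbθ : ∀ k, b ^ θ k = (2 : ℝ) ^ ((g : ℤ) * θ k) := fun k => by rw [hb, ← zpow_mul]
  set T : Fin K → Matrix (Fin m) (Fin m) ℝ := patchMatrix b v ε with hT
  set P : ℝ[X] := (∑ l, ((Polynomial.X : Polynomial ℝ) ^ d l) • (T l).map Polynomial.C).det with hP
  -- sign alternation of `P` at the dyadic points
  have haltP : ∀ k : Fin n, P.eval ((2 : ℝ) ^ ((g : ℤ) * θ k.castSucc)) * P.eval ((2 : ℝ) ^ ((g : ℤ) * θ k.succ)) < 0 := by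
    intro k
    have A := det_patch_alternates b d v ε hε θ p hdom halt hbN k
    rw [hP, eval_det_pencil, eval_det_pencil, ← hbθ, ← hbθ]
    exact A
  have hP0 : P ≠ 0 := by
    rcases n.eq_zero_or_pos with hn | hn
    · -- no alternation needed: use dominance at θ 0 — the determinant is nonzero at b^θ₀
      intro h0
      have A := Summit.ValiantsHypothesis.ValiantsHypothesis.Theorems.MatrixDescartes.Negative.det_patch_sign
        b d v ε hε (θ 0) (p 0) (hdom 0) hbN
      have : P.eval (b ^ θ 0) = 0 := by rw [h0, eval_zero]
      rw [hP, eval_det_pencil] at this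
      rw [this, mul_zero] at A
      exact lt_irrefl _ A
    · intro h0
      have := haltP ⟨0, hn⟩
      rw [h0, eval_zero, zero_mul] at this
      exact lt_irrefl _ this
  refine ⟨SD T, SD_isSymm T, ?_⟩
  rw [det_pencil_SD, octaveCount_C_mul_sq _ (pow_ne_zero _ (by norm_num))]
  exact le_octaveCount_of_alternating_zpow P hP0 g (by omega) θ hθ haltP

/-! ## 4. Ω-B ⟹ TropicalB, and the octave route is exactly Ω-B -/

/-- size bookkeeping: `(K+1) + ⌊log₂(2m)⌋² ≤ 4·(K + ⌊log₂ m⌋²)` for `K ≥ 1`. -/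
theorem doubling_budget_le {m K : ℕ} (hK : 1 ≤ K) : (K + 1) + Nat.log 2 (m + m) ^ 2 ≤ 4 * (K + Nat.log 2 m ^ 2) := by
  have hL : Nat.log 2 (m + m) ≤ Nat.log 2 m + 1 := by
    rcases Nat.eq_zero_or_pos m with rfl | hm
    · simp
    have h1 : m < 2 ^ (Nat.log 2 m + 1) := Nat.lt_pow_succ_log_self one_lt_two m
    have h2 : m + m < 2 ^ (Nat.log 2 m + 2) := by rw [pow_succ]; omega
    have := Nat.log_lt_of_lt_pow (by omega) h2
    omega
  have h3 : Nat.log 2 (m + m) ^ 2 ≤ (Nat.log 2 m + 1) ^ 2 := Nat.pow_le_pow_left hL 2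
  nlinarith [Nat.zero_le (Nat.log 2 m)]

/-- **Ω-B ⟹ TropicalB** (`C ↦ 4C`): every tropical monster is an octave monster. -/
theorem tropicalB_of_octaveKLaw (h : ∃ C : ℕ, ∀ m K : ℕ, OctaveRootLawAt m K (2 ^ (C * (K + Nat.log 2 m ^ 2)))) :
    TropicalB := by
  obtain ⟨C, hC⟩ := h
  refine ⟨4 * C, fun m K d v ε n θ p hε hθ hdom halt => ?_⟩
  rcases Nat.eq_zero_or_pos K with rfl | hK
  · -- K = 0: no Leibniz term can alternate, so n = 0
    rcases n with _ | n
    · exact Nat.zero_le _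
    exfalso
    rcases Nat.eq_zero_or_pos m with rfl | hm
    · have hts : ∀ q : Equiv.Perm (Fin 0) × (Fin 0 → Fin 0), termSign ε q = 1 := fun q => by
        simp [termSign, Subsingleton.elim q.1 1]
      have := halt 0
      rw [hts, hts] at this
      norm_num at this
    · exact Fin.elim0 ((p 0).2 ⟨0, hm⟩)
  · obtain ⟨S, hS, hn⟩ := octaves_of_signedChain d v ε hε θ hθ p hdom halt
    have hΩ := hC (m + m) (K + 1) (dD d) S hS
    calc n ≤ _ := hn
      _ ≤ 2 ^ (C * ((K + 1) + Nat.log 2 (m + m) ^ 2)) := hΩ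
      _ ≤ 2 ^ (4 * C * (K + Nat.log 2 m ^ 2)) := Nat.pow_le_pow_right two_pos (by
          have := doubling_budget_le (m := m) hK
          calc C * ((K + 1) + Nat.log 2 (m + m) ^ 2) ≤ C * (4 * (K + Nat.log 2 m ^ 2)) := Nat.mul_le_mul_left C this
            _ = 4 * C * (K + Nat.log 2 m ^ 2) := by ring)

/-- Ω-B ⟹ Ω-W (trivial direction: `(n+1) ≥ 1`). -/
theorem octaveWeakLifting_of_octaveKLaw (h : ∃ C : ℕ, ∀ m K : ℕ, OctaveRootLawAt m K (2 ^ (C * (K + Nat.log 2 m ^ 2)))) :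
    OctaveWeakLifting := by
  obtain ⟨C, hC⟩ := h
  exact ⟨C, fun m K n _ => octaveRootLawAt_mono (Nat.le_mul_of_pos_right _ (Nat.succ_pos n)) (hC m K)⟩

/-- **THE OCTAVE ROUTE IS EXACTLY Ω-B.**  `Ω-B ↔ TropicalB ∧ OctaveWeakLifting` (→ new here; ← is the landed glue). -/
theorem octaveKLaw_iff :
    (∃ C : ℕ, ∀ m K : ℕ, OctaveRootLawAt m K (2 ^ (C * (K + Nat.log 2 m ^ 2)))) ↔ (TropicalB ∧ OctaveWeakLifting) :=
  ⟨fun h => ⟨tropicalB_of_octaveKLaw h, octaveWeakLifting_of_octaveKLaw h⟩,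
   fun h => octaveKLaw_of_tropicalB_of_octaveWeakLifting h.1 h.2⟩

/-- NEGATIVE-KNOWLEDGE TRANSFER: a refutation of `TropicalB` (a tropical monster of the `K + log² m` shape) refutes Ω-B. -/
theorem not_octaveKLaw_of_not_tropicalB (h : ¬ TropicalB) :
    ¬ (∃ C : ℕ, ∀ m K : ℕ, OctaveRootLawAt m K (2 ^ (C * (K + Nat.log 2 m ^ 2)))) :=
  fun hΩ => h (tropicalB_of_octaveKLaw hΩ)

/-- the tropical capacity is below the octave capacity of the doubled format: `TropRow` form. -/
theorem signedRow_of_octaveRootLawAt {m K B : ℕ}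
    (h : OctaveRootLawAt (m + m) (K + 1) B) :
    ∀ (d : Fin K → ℕ) (v ε : Fin m → Fin m → Fin K → ℤ) (n : ℕ) (θ : Fin (n + 1) → ℤ)
      (p : Fin (n + 1) → Equiv.Perm (Fin m) × (Fin m → Fin K)),
      (∀ i j l, (ε i j l).natAbs ≤ 1) → StrictMono θ → (∀ k, IsDominant d v ε (θ k) (p k)) →
      (∀ k : Fin n, termSign ε (p k.castSucc) * termSign ε (p k.succ) < 0) → n ≤ B := by
  intro d v ε n θ p hε hθ hdom halt
  obtain ⟨S, hS, hn⟩ := octaves_of_signedChain d v ε hε θ hθ p hdom halt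
  exact hn.trans (h (dD d) S hS)

end Summit.ValiantsHypothesis.ValiantsHypothesis.Cruxes.OctaveWeakLifting.OctaveExact
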